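import Mathlib
import HarnessLib
import Literature.MathematicalPhysics.QuantumFieldTheory.YangMillsOS
import Literature.MathematicalPhysics.QuantumFieldTheory.SpeciesTimeReflection
import Literature.MathematicalPhysics.QuantumFieldTheory.WilsonAxisSymmetry
import Summits.QuantumFields.YangMills.Theorems.PencilRigidityCurvatureKernelBoundLatticeWindowPairOfOne

/-!
# `CurvatureKernelBound` (stmt-QuantumFields-11687), line `sixteen-charts-analytic-kernel`, skeleton v13 — stub `CovAxisNormalisation`

Crux declaration: `Summit.QuantumFields.YangMills.Theses.PencilRigidity.CurvatureKernelBound`.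

**What is proved (stub P of the lead's skeleton v13: hypercubic bookkeeping).** Write
`Cov(w) = ∫ Q(Ũ) Q(τ_w Ũ) dμ − (∫ Q(Ũ) dμ)(∫ Q(τ_w Ũ) dμ)` for the truncated plaquette covariance of
Wilson's measure `μ = wilsonMeasure r.ρ β` on the odd torus `(ℤ/(2L+1))⁴` in lifted form
(`Ũ = torusLift (2L+1) U`, `τ_w = configShift (−w)`, `Q = r.curvature.F` the action density). For a
separation `z ∈ ℤ⁴` with `z i = ±n` there is `z'` with TIME component `z' 0 = n` and `Cov(z') = Cov(z)`:
the lead's axis domination `AxisDominationOfForm` may therefore assume the sup-norm of the separation is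
attained, positively, on the time axis.

**Proof.** (a) `z i = n`: `z' := sitePermZd (swap 0 i) z`; Wilson's torus measure and the action
density are invariant under permutations of the axes (tree `integral_comp_configPerm_wilsonMeasure`,
`LatticeRep.curvature_F_configPermZd`, `LatticeRep.curvature_F_perm_torusLift`, `configPermZd_torusLift`),
whence `Cov(sitePermZd π z) = Cov(z)` (`torusCov_sitePermZd_eq`). (b) `z i = −n`: `Cov(−z) = Cov(z)` by
translation invariance of the torus state in lifted form (tree `integral_comp_configShift_torusLift`,
`LatticeWindow.configShift_configShift`, `LatticeWindow.configShift_zero`) and symmetry of the product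
(`torusCov_neg_eq`); then (a) for `−z`.

References: K. Wilson, Phys. Rev. D 10 (1974) 2445; E. Seiler, LNP 159 (1982) Ch. 1–2 (hypercubic and
translation invariance of Wilson's action and of the product Haar measure). [folklore]
-/
noncomputable section

open scoped BigOperators Topology ComplexConjugate
open Filter Set Function TopologicalSpace MeasureTheory
open Literature.MathematicalPhysics.QuantumLattice Literature.MathematicalPhysics.AQFT Literature.MathematicalPhysics.QuantumFieldTheory

namespace Summit.QuantumFields.YangMills.Theorems.CurvatureKernel

section Helpers

open Literature.Probability.LatticeModels (Site)

variable {G : Type} [Group G] [TopologicalSpace G] [IsTopologicalGroup G] [CompactSpace G]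
  [MeasurableSpace G] [BorelSpace G]

/-- **Axis permutations preserve the truncated plaquette covariance of the torus Wilson state.**
For a permutation `π` of the four axes, `Cov(sitePermZd π z) = Cov(z)`, where
`Cov(w) = ∫ Q(Ũ) Q(τ_w Ũ) dμ − (∫ Q(Ũ) dμ)(∫ Q(τ_w Ũ) dμ)`, `Q = r.curvature.F`, `Ũ = torusLift T U`,
`τ_w = configShift (−w)`, `μ = wilsonMeasure r.ρ β` on `(ℤ/T)⁴`: change variables `U ↦ configPerm π U`
(`integral_comp_configPerm_wilsonMeasure`) and use the invariance of the action density read on the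
periodic lift (`LatticeRep.curvature_F_configPermZd`, `LatticeRep.curvature_F_perm_torusLift`). [folklore] -/
theorem torusCov_sitePermZd_eq (r : LatticeRep G) (β : ℝ) (T : ℕ) [NeZero T]
    (π : Equiv.Perm (Fin 4)) (z : Site 4) :
    (∫ U, r.curvature.F (torusLift T U) * r.curvature.F (configShift (-(sitePermZd π z)) (torusLift T U))
        ∂(wilsonMeasure r.ρ β : MeasureTheory.Measure (GaugeConfig 4 T G))) -
      (∫ U, r.curvature.F (torusLift T U) ∂(wilsonMeasure r.ρ β : MeasureTheory.Measure (GaugeConfig 4 T G))) *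
      (∫ U, r.curvature.F (configShift (-(sitePermZd π z)) (torusLift T U))
        ∂(wilsonMeasure r.ρ β : MeasureTheory.Measure (GaugeConfig 4 T G))) =
    (∫ U, r.curvature.F (torusLift T U) * r.curvature.F (configShift (-z) (torusLift T U))
        ∂(wilsonMeasure r.ρ β : MeasureTheory.Measure (GaugeConfig 4 T G))) -
      (∫ U, r.curvature.F (torusLift T U) ∂(wilsonMeasure r.ρ β : MeasureTheory.Measure (GaugeConfig 4 T G))) *
      (∫ U, r.curvature.F (configShift (-z) (torusLift T U))
        ∂(wilsonMeasure r.ρ β : MeasureTheory.Measure (GaugeConfig 4 T G))) := by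
  have hperm : ∀ U : GaugeConfig 4 T G,
      r.curvature.F (torusLift T (configPerm π U)) = r.curvature.F (torusLift T U) := fun U => by
    rw [← configPermZd_torusLift, LatticeRep.curvature_F_configPermZd]
  have hperm' := LatticeRep.curvature_F_perm_torusLift r T π z
  have h2 := integral_comp_configPerm_wilsonMeasure (L := T) r.ρ r.continuous β π
    (fun U : GaugeConfig 4 T G => r.curvature.F (torusLift T U) *
      r.curvature.F (configShift (-(sitePermZd π z)) (torusLift T U)))
  have h1 := integral_comp_configPerm_wilsonMeasure (L := T) r.ρ r.continuous β π
    (fun U : GaugeConfig 4 T G => r.curvature.F (configShift (-(sitePermZd π z)) (torusLift T U)))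
  simp only [hperm, hperm'] at h2 h1
  rw [← h2, ← h1]

/-- **The truncated covariance of the torus Wilson state is even in the separation.** For a lifted
observable `F` on the torus `(ℤ/T)⁴`, `Cov(−z) = Cov(z)` with
`Cov(w) = ∫ F(Ũ) F(τ_w Ũ) dμ − (∫ F(Ũ) dμ)(∫ F(τ_w Ũ) dμ)`: translate by `z`
(`integral_comp_configShift_torusLift`, `τ_{−z} ∘ θ_z = id`) and commute the two factors. [folklore] -/
theorem torusCov_neg_eq {N : ℕ} (ρ : G →* Matrix (Fin N) (Fin N) ℂ) (β : ℝ) (T : ℕ) [NeZero T]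
    (F : LGConfig 4 G → ℝ) (z : Site 4) :
    (∫ U, F (torusLift T U) * F (configShift (-(-z)) (torusLift T U))
        ∂(wilsonMeasure ρ β : MeasureTheory.Measure (GaugeConfig 4 T G))) -
      (∫ U, F (torusLift T U) ∂(wilsonMeasure ρ β : MeasureTheory.Measure (GaugeConfig 4 T G))) *
      (∫ U, F (configShift (-(-z)) (torusLift T U))
        ∂(wilsonMeasure ρ β : MeasureTheory.Measure (GaugeConfig 4 T G))) =
    (∫ U, F (torusLift T U) * F (configShift (-z) (torusLift T U))
        ∂(wilsonMeasure ρ β : MeasureTheory.Measure (GaugeConfig 4 T G))) -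
      (∫ U, F (torusLift T U) ∂(wilsonMeasure ρ β : MeasureTheory.Measure (GaugeConfig 4 T G))) *
      (∫ U, F (configShift (-z) (torusLift T U))
        ∂(wilsonMeasure ρ β : MeasureTheory.Measure (GaugeConfig 4 T G))) := by
  have h2 := integral_comp_configShift_torusLift (d := 4) (S := T) ρ β
    (fun V => F (configShift (-z) V) * F V) z
  have h1 := integral_comp_configShift_torusLift (d := 4) (S := T) ρ β
    (fun V => F (configShift (-z) V)) z
  have h1' := integral_comp_configShift_torusLift (d := 4) (S := T) ρ β F z
  simp only [LatticeWindow.configShift_configShift, neg_add_cancel, LatticeWindow.configShift_zero]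
    at h2 h1
  rw [neg_neg, h2, h1', ← h1]
  congr 1
  exact integral_congr_ae (Filter.Eventually.of_forall fun U => mul_comm _ _)

end Helpers

/-- **`CovAxisNormalisation`** (stub P of skeleton v13 of line `sixteen-charts-analytic-kernel`,
crux stmt-QuantumFields-11687 `PencilRigidity.CurvatureKernelBound`): hypercubic normalisation of the
separation in the truncated plaquette covariance of Wilson's measure on the odd torus `(ℤ/(2L+1))⁴`.
If `z i = n` or `z i = −n` for some axis `i`, there is `z' ∈ ℤ⁴` with time component `z' 0 = n` and
`Cov(z) = Cov(z')`, `Cov(w) = ∫ Q(Ũ) Q(τ_w Ũ) dμ − (∫ Q(Ũ) dμ)(∫ Q(τ_w Ũ) dμ)` (`Q = r.curvature.F`,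
`Ũ = torusLift (2L+1) U`, `τ_w = configShift (−w)`, `μ = wilsonMeasure r.ρ β`). Take
`z' = sitePermZd (swap 0 i) z`, resp. `sitePermZd (swap 0 i) (−z)`: axis permutations
(`torusCov_sitePermZd_eq`) and the reflection `z ↦ −z` (`torusCov_neg_eq`) preserve `Cov`. [folklore] -/
theorem CovAxisNormalisation : open Literature.MathematicalPhysics.QuantumLattice Literature.MathematicalPhysics.AQFT Literature.MathematicalPhysics.QuantumFieldTheory in ∀ (G : Type) [Group G] [TopologicalSpace G] [IsTopologicalGroup G] [CompactSpace G] [MeasurableSpace G] [BorelSpace G] (r : LatticeRep G) (β : ℝ) (L : ℕ) (z : Literature.Probability.LatticeModels.Site 4) (i : Fin 4) (n : ℕ), (z i = n ∨ z i = -n) → ∃ z' : Literature.Probability.LatticeModels.Site 4, z' 0 = n ∧ ((∫ U, r.curvature.F (torusLift (2 * L + 1) U) * r.curvature.F (configShift (-z) (torusLift (2 * L + 1) U)) ∂(wilsonMeasure r.ρ β : MeasureTheory.Measure (GaugeConfig 4 (2 * L + 1) G))) - (∫ U, r.curvature.F (torusLift (2 * L + 1) U) ∂(wilsonMeasure r.ρ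 β : MeasureTheory.Measure (GaugeConfig 4 (2 * L + 1) G))) * (∫ U, r.curvature.F (configShift (-z) (torusLift (2 * L + 1) U)) ∂(wilsonMeasure r.ρ β : MeasureTheory.Measure (GaugeConfig 4 (2 * L + 1) G)))) = ((∫ U, r.curvature.F (torusLift (2 * L + 1) U) * r.curvature.F (configShift (-z') (torusLift (2 * L + 1) U)) ∂(wilsonMeasure r.ρ β : MeasureTheory.Measure (GaugeConfig 4 (2 * L + 1) G))) - (∫ U, r.curvature.F (torusLift (2 * L + 1) U) ∂(wilsonMeasure r.ρ β : MeasureTheory.Measure (GaugeConfig 4 (2 * L + 1) G))) * (∫ U, r.curvature.F (configShift (-z') (torusLift (2 * L + 1) U)) ∂(wilsonMeasure r.ρ β : MeasureTheory.Measure (GaugeConfig 4 (2 * L + 1) G)))) := by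
  intro G _ _ _ _ _ _ r β L z i n hz
  rcases hz with hz | hz
  · refine ⟨sitePermZd (Equiv.swap 0 i) z, ?_, ?_⟩
    · simp only [sitePermZd_apply, Equiv.symm_swap, Equiv.swap_apply_left, hz]
    · exact (torusCov_sitePermZd_eq r β (2 * L + 1) (Equiv.swap 0 i) z).symm
  · refine ⟨sitePermZd (Equiv.swap 0 i) (-z), ?_, ?_⟩
    · simp only [sitePermZd_apply, Equiv.symm_swap, Equiv.swap_apply_left, Pi.neg_apply, hz, neg_neg]
    · rw [torusCov_sitePermZd_eq r β (2 * L + 1) (Equiv.swap 0 i) (-z),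
        torusCov_neg_eq r.ρ β (2 * L + 1) r.curvature.F z]

end Summit.QuantumFields.YangMills.Theorems.CurvatureKernel

end
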